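import Literature.AnabelianGeometry.SemiGraphs.OrbitGraphMap

/-!
# Elementary properties of the splitting relation `CovObj.Splits` ([SemiAnbd] Def. 3.5 (ii)) — proofs

Proof-only file.  `F.Splits S` (the stabiliser of any point of `F` acts trivially on the
corresponding fibre of `S`, `TemperedCoverings.lean`) is (i) inherited along morphisms
`A ⟶ F` (a dominating covering splits more: `Splits.of_hom`), and (ii) transitive through a
covering with nonempty fibres (`Splits.trans`).  Used to see that the levels of the Galois tower
split every component of a tempered covering ([SemiAnbd] p. 38, proof of Prop. 3.6: "cofinal").
-/

namespace Literature.AnabelianGeometry.SemiGraphs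

namespace ProfiniteSemiGraph

open CategoryTheory

universe u

variable {𝒢 : ProfiniteSemiGraph.{u}} {A F S : CovObj 𝒢}

/-- A covering dominating a splitting covering splits: if `A ⟶ F` and `F` splits `S` then `A`
splits `S` (stabilisers only shrink along equivariant maps). [cite: MochizukiSemiAnbd2006, Def 3.5(ii) p.37] -/
theorem CovObj.Splits.of_hom (f : A ⟶ F) (h : F.Splits S) : A.Splits S := by
  refine ⟨fun v a g hga s => ?_, fun e a g hga s => ?_⟩
  · refine h.1 v ((f.fV v).hom.hom a) g ?_ s
    rw [← CovHom.fV_ρ, hga]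
  · refine h.2 e ((f.fE e).hom.hom a) g ?_ s
    rw [← CovHom.fE_ρ, hga]

/-- Splitting is transitive through a covering with nonempty fibres.
[cite: MochizukiSemiAnbd2006, Def 3.5(ii) p.37] -/
theorem CovObj.Splits.trans (hAF : A.Splits F) (hne : F.HasNonemptyFibres) (hFS : F.Splits S) :
    A.Splits S := by
  refine ⟨fun v a g hga s => ?_, fun e a g hga s => ?_⟩
  · obtain ⟨x⟩ := hne.nonempty_V v
    exact hFS.1 v x g (hAF.1 v a g hga x) s
  · obtain ⟨x⟩ := hne.nonempty_E e
    exact hFS.2 e x g (hAF.2 e a g hga x) s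

/-- Splitting is inherited by the coverings split BY the split one... (monotonicity in the second
argument along morphisms INTO it): if `F` splits `S` and `S' ⟶ S` is injective on fibres then `F`
splits `S'`. [cite: MochizukiSemiAnbd2006, Def 3.5(ii) p.37] -/
theorem CovObj.Splits.of_hom_right {S' : CovObj 𝒢} (i : S' ⟶ S)
    (hinjV : ∀ v, Function.Injective (i.fV v).hom.hom) (hinjE : ∀ e, Function.Injective (i.fE e).hom.hom)
    (h : F.Splits S) : F.Splits S' := by
  refine ⟨fun v x g hgx s => ?_, fun e x g hgx s => ?_⟩
  · apply hinjV v
    rw [CovHom.fV_ρ]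
    exact h.1 v x g hgx _
  · apply hinjE e
    rw [CovHom.fE_ρ]
    exact h.2 e x g hgx _

end ProfiniteSemiGraph

end Literature.AnabelianGeometry.SemiGraphs
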